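import Mathlib
import HarnessLib
import Literature.NumberTheory.GaloisRepresentations.NearlyOrdinaryDeformationRing
import Literature.NumberTheory.GaloisRepresentations.PadicIntermediateFieldIntegers

/-!
# The residue-restricted test ring `𝒪_L ×_{k_L} k` (stub (P2) `stub_seedPatchingPrime`, coefficient plumbing)

Route `SkinnerWilesDefectOne`, crux `ReducibleOrdinaryProModular` (stmt-Langlands-12919), line
`fine-selmer-codimension-two`, stub (P2) `stub_seedPatchingPrime`.  The landed reduction
`stub_seedPatchingPrime_auxOfTypeD` (`…SeedPatchingPrime.lean`) needs the seed's `r` as a deformation of type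
`M.𝒟` over a TEST RING of the interface `NearlyOrdinaryDeformationRing` — a complete Noetherian local
`𝒪`-algebra whose residue field is EXACTLY `k = M.k` —, whereas a lattice of `r` naturally lives over the
integers `𝒪_L` of a finite `L/ℚ_p`, whose residue field `k_L` is in general bigger than `k`.  The standard
remedy ([Mazur, §10]: coefficient rings with residue field `k`; the fibre product `𝒪_L ×_{k_L} k`) is built
here, sorry-free, for `𝒪_L = intermediateFieldIntegers p L` and a field embedding `κ : k → k_L`:

* the subring `A = {a ∈ 𝒪_L | a mod λ ∈ κ(k)} = Subring.comap residue κ.range` (NO new definition is introduced: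
  the lemmas are stated for any subring `A` with this membership characterisation `hA`, and the registered
  statement instantiates `A := Subring.comap residue κ.range`, `mem_comap_range_iff`; `A ⊇ 𝔪_L`);
* it is LOCAL with `𝔪_A = A ∩ 𝔪_L` (`isLocalRing`, `mem_maximalIdeal_iff`; the three structure results are
  THEOREMS — introduce them with `haveI` —, not global instances), and
  `𝔪_A^n ⊆ 𝔪_L^n ∩ A`, `𝔪_L^{n+1} ∩ A ⊆ 𝔪_A^n` (`coe_mem_pow`, `mem_pow_of_coe_mem_pow_succ`);
* NOETHERIAN (`isNoetherianRing`): a non-zero ideal `I ∋ a`, `(a) = 𝔪_L^m`, contains `𝔪_A^{m+1}`, and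
  `A/𝔪_A^{m+1}` is finite (it is a quotient of `A/(𝔪_L^{m+2} ∩ A) ↪ 𝒪_L/𝔪_L^{m+2}`), so `I` is finitely
  generated once `𝔪_A` is — and `𝔪_A = (ϖ·[c], ϖ)_{c ∈ k_L}` explicitly;
* COMPLETE (`isAdicComplete`): Cauchy sequences converge in `𝒪_L` and the limit has residue in `κ(k)`;
* the augmentation (`exists_lift`): a surjection `π : A →+* k` with `κ ∘ π = residue` (namely `κ⁻¹ ∘ residue`).

The registered sub-goal `stub_seedPatchingPrime_auxResidueRestrict` packages this as an existence statement.
The Galois half (an `𝒪_L`-lattice reducing into `κ(k)` is a type-`𝒟` deformation over this ring) is the sequel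
`…SeedPatchingPrimeLattice.lean`.

References: B. Mazur, *An introduction to the deformation theory of Galois representations* (1997), §10
(coefficient-rings with residue field `k`) [Mazur1997Deformation]; C. M. Skinner, A. J. Wiles, Publ. Math.
IHÉS 89 (1999), §2.1 [SkinnerWiles1999]; J.-P. Serre, *Local Fields*, II §1 [SerreLocalFields1979].
-/

set_option linter.dupNamespace false -- project-wide option (lakefile weak.linter.dupNamespace); `Summit.Langlands.Langlands` is the mandated namespace
set_option autoImplicit false

namespace Summit.Langlands.Langlands.Cruxes.ReducibleOrdinaryProModular.FineSelmerCodimensionTwo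

open IsLocalRing Literature.NumberTheory.GaloisRepresentations

noncomputable section

namespace ResidueRestrict

variable {p : ℕ} [Fact p.Prime] (L : IntermediateField ℚ_[p] (PadicAlgCl p))
variable {k : Type} [Field k] (κ : k →+* ResidueField (intermediateFieldIntegers p L))

/-- Membership in the residue-restricted ring `Subring.comap residue κ.range = {a ∈ 𝒪_L | a mod λ_L ∈ κ(k)}`
(Mazur's `𝒪_L ×_{k_L} k` [Mazur, §10]): `residue a = κ y` for some `y`. [folklore] -/
theorem mem_comap_range_iff {a : intermediateFieldIntegers p L} :
    a ∈ (κ.range).comap (residue (intermediateFieldIntegers p L)) ↔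
      ∃ y : k, κ y = residue (intermediateFieldIntegers p L) a := by
  simp [Subring.mem_comap, RingHom.mem_range]

variable {A : Subring (intermediateFieldIntegers p L)}
  (hA : ∀ a : intermediateFieldIntegers p L, a ∈ A ↔ ∃ y : k, κ y = residue (intermediateFieldIntegers p L) a)
include hA

/-- `𝔪_L ⊆ A`. [folklore] -/
theorem mem_of_mem_maximalIdeal {a : intermediateFieldIntegers p L}
    (ha : a ∈ maximalIdeal (intermediateFieldIntegers p L)) : a ∈ A :=
  (hA _).2 ⟨0, by rw [map_zero, (residue_eq_zero_iff _).2 ha]⟩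

/-- An element of `A` with non-zero residue is a unit OF `A` (its inverse in `𝒪_L` has residue
`κ(y)⁻¹ = κ(y⁻¹)`). [folklore] -/
theorem isUnit_of_residue_ne_zero (a : A)
    (ha : residue (intermediateFieldIntegers p L) (a : intermediateFieldIntegers p L) ≠ 0) : IsUnit a := by
  have hu : IsUnit (a : intermediateFieldIntegers p L) := by
    by_contra h
    exact ha ((residue_eq_zero_iff _).2 ((IsLocalRing.mem_maximalIdeal _).2 (mem_nonunits_iff.2 h)))
  obtain ⟨u, hu⟩ := hu
  obtain ⟨y, hy⟩ := (hA _).1 a.2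
  have hinv : residue (intermediateFieldIntegers p L) (↑u⁻¹ : intermediateFieldIntegers p L) =
      (residue (intermediateFieldIntegers p L) (a : intermediateFieldIntegers p L))⁻¹ := by
    refine (eq_inv_of_mul_eq_one_left ?_)
    rw [← map_mul, ← hu, Units.inv_mul, map_one]
  have hmem : (↑u⁻¹ : intermediateFieldIntegers p L) ∈ A :=
    (hA _).2 ⟨y⁻¹, by rw [map_inv₀, hy, hinv]⟩
  refine isUnit_iff_exists_inv.2 ⟨⟨↑u⁻¹, hmem⟩, Subtype.ext ?_⟩
  change (a : intermediateFieldIntegers p L) * ↑u⁻¹ = 1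
  rw [← hu, Units.mul_inv]

/-- `A` is a local ring. [cite: Mazur1997Deformation, §10] -/
theorem isLocalRing : IsLocalRing A :=
  IsLocalRing.of_isUnit_or_isUnit_one_sub_self fun a => by
    by_cases h : residue (intermediateFieldIntegers p L) (a : intermediateFieldIntegers p L) = 0
    · refine Or.inr (isUnit_of_residue_ne_zero L κ hA _ ?_)
      change residue _ (1 - (a : intermediateFieldIntegers p L)) ≠ 0
      rw [map_sub, map_one, h, sub_zero]
      exact one_ne_zero
    · exact Or.inl (isUnit_of_residue_ne_zero L κ hA a h)

/-- `𝔪_A = A ∩ 𝔪_L`. [folklore] -/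
theorem mem_maximalIdeal_iff (a : A) :
    haveI := isLocalRing L κ hA; a ∈ maximalIdeal A ↔
      (a : intermediateFieldIntegers p L) ∈ maximalIdeal (intermediateFieldIntegers p L) := by
  haveI := isLocalRing L κ hA
  rw [IsLocalRing.mem_maximalIdeal, mem_nonunits_iff, IsLocalRing.mem_maximalIdeal, mem_nonunits_iff]
  constructor
  · intro h hu
    have hne : residue (intermediateFieldIntegers p L) (a : intermediateFieldIntegers p L) ≠ 0 := by
      rwa [Ne, residue_eq_zero_iff, IsLocalRing.mem_maximalIdeal, mem_nonunits_iff, not_not]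
    exact h (isUnit_of_residue_ne_zero L κ hA a hne)
  · intro h hu
    exact h (hu.map (A).subtype)

/-- `𝔪_A^n ⊆ 𝔪_L^n`. [folklore] -/
theorem coe_mem_pow {n : ℕ} {a : A} (h : haveI := isLocalRing L κ hA; a ∈ maximalIdeal A ^ n) :
    (a : intermediateFieldIntegers p L) ∈ maximalIdeal (intermediateFieldIntegers p L) ^ n := by
  haveI := isLocalRing L κ hA
  have h1 : (maximalIdeal (A)).map (A).subtype ≤ maximalIdeal (intermediateFieldIntegers p L) :=
    Ideal.map_le_iff_le_comap.2 fun x hx => (mem_maximalIdeal_iff L κ hA x).1 hx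
  have h2 := Ideal.mem_map_of_mem (A).subtype h
  rw [Ideal.map_pow] at h2
  exact Ideal.pow_right_mono h1 n h2

/-- `𝔪_L^{n+1} ∩ A ⊆ 𝔪_A^n` (`x = ϖ^n · (ϖ t)` with `ϖ ∈ 𝔪_A`, `ϖ t ∈ 𝔪_L ⊆ A`). [folklore] -/
theorem mem_pow_of_coe_mem_pow_succ [FiniteDimensional ℚ_[p] L] {n : ℕ} {a : A}
    (h : (a : intermediateFieldIntegers p L) ∈ maximalIdeal (intermediateFieldIntegers p L) ^ (n + 1)) :
    haveI := isLocalRing L κ hA; a ∈ maximalIdeal A ^ n := by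
  haveI := isLocalRing L κ hA
  rw [intermediateFieldIntegers.maximalIdeal_eq_span_uniformizer, Ideal.span_singleton_pow,
    Ideal.mem_span_singleton'] at h
  obtain ⟨t, ht⟩ := h
  set ϖ := intermediateFieldIntegers.uniformizer L with hϖ
  have hϖm : ϖ ∈ maximalIdeal (intermediateFieldIntegers p L) := by
    rw [intermediateFieldIntegers.maximalIdeal_eq_span_uniformizer]; exact Ideal.mem_span_singleton_self _
  let ϖA : A := ⟨ϖ, mem_of_mem_maximalIdeal L κ hA hϖm⟩
  have hϖA : ϖA ∈ maximalIdeal (A) := (mem_maximalIdeal_iff L κ hA ϖA).2 hϖm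
  have hts : t * ϖ ∈ maximalIdeal (intermediateFieldIntegers p L) := Ideal.mul_mem_left _ _ hϖm
  let s : A := ⟨t * ϖ, mem_of_mem_maximalIdeal L κ hA hts⟩
  have ha : a = s * ϖA ^ n := Subtype.ext (by
    change (a : intermediateFieldIntegers p L) = t * ϖ * ϖ ^ n
    rw [← ht, pow_succ]; ring)
  rw [ha]
  exact Ideal.mul_mem_left _ _ (Ideal.pow_mem_pow hϖA n)

/-- A non-zero ideal of `A` contains a power of `𝔪_A` (`(a) = 𝔪_L^m` in the DVR `𝒪_L`, then
`𝔪_A^{m+1} ⊆ 𝔪_L^{m+1} ∩ A = a · 𝔪_L ⊆ I`). [folklore] -/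
theorem exists_pow_le_of_ne_bot [FiniteDimensional ℚ_[p] L] {I : Ideal A} (hI : I ≠ ⊥) :
    haveI := isLocalRing L κ hA; ∃ m : ℕ, maximalIdeal A ^ (m + 1) ≤ I := by
  haveI := isLocalRing L κ hA
  obtain ⟨a, haI, ha0⟩ := Submodule.exists_mem_ne_zero_of_ne_bot hI
  haveI : IsDiscreteValuationRing (intermediateFieldIntegers p L) :=
    { not_a_field' := intermediateFieldIntegers.maximalIdeal_ne_bot L }
  have ha0' : (a : intermediateFieldIntegers p L) ≠ 0 := fun h => ha0 (Subtype.ext h)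
  set ϖ := intermediateFieldIntegers.uniformizer L with hϖ
  have hirr : Irreducible ϖ :=
    (IsDiscreteValuationRing.irreducible_iff_uniformizer ϖ).2
      (intermediateFieldIntegers.maximalIdeal_eq_span_uniformizer L)
  obtain ⟨m, hm⟩ := IsDiscreteValuationRing.ideal_eq_span_pow_irreducible
    (show Ideal.span {(a : intermediateFieldIntegers p L)} ≠ ⊥ by
      rwa [Ne, Ideal.span_singleton_eq_bot]) hirr
  obtain ⟨u, hu⟩ := Ideal.span_singleton_eq_span_singleton.1 hm
  refine ⟨m, fun x hx => ?_⟩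
  have hx' := coe_mem_pow L κ hA hx
  rw [intermediateFieldIntegers.maximalIdeal_eq_span_uniformizer, Ideal.span_singleton_pow,
    Ideal.mem_span_singleton'] at hx'
  obtain ⟨c, hc⟩ := hx'
  -- `x = c ϖ^{m+1} = a · (u c ϖ)` with `u c ϖ ∈ 𝔪_L ⊆ A`
  have hϖm : ϖ ∈ maximalIdeal (intermediateFieldIntegers p L) := by
    rw [intermediateFieldIntegers.maximalIdeal_eq_span_uniformizer]; exact Ideal.mem_span_singleton_self _
  have htm : (↑u * c * ϖ : intermediateFieldIntegers p L) ∈ maximalIdeal (intermediateFieldIntegers p L) :=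
    Ideal.mul_mem_left _ _ hϖm
  let t : A := ⟨↑u * c * ϖ, mem_of_mem_maximalIdeal L κ hA htm⟩
  have hxt : x = a * t := Subtype.ext (by
    change (x : intermediateFieldIntegers p L) = a * (↑u * c * ϖ)
    rw [← hc, pow_succ, ← hu]; ring)
  rw [hxt]
  exact Ideal.mul_mem_right _ _ haI

/-- `A / 𝔪_A^{m+1}` is finite (a quotient of `A/(𝔪_L^{m+2} ∩ A) ↪ 𝒪_L/𝔪_L^{m+2}`). [folklore] -/
theorem finite_quotient_pow [FiniteDimensional ℚ_[p] L] (m : ℕ) :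
    haveI := isLocalRing L κ hA; Finite (A ⧸ maximalIdeal A ^ (m + 1)) := by
  haveI := isLocalRing L κ hA
  haveI := intermediateFieldIntegers.finite_residueField L
  haveI : Finite (intermediateFieldIntegers p L ⧸ maximalIdeal (intermediateFieldIntegers p L) ^ (m + 2)) :=
    IsLocalRing.finite_quotient_iff.2 ⟨m + 2, le_rfl⟩
  set K : Ideal (A) := (maximalIdeal (intermediateFieldIntegers p L) ^ (m + 2)).comap (A).subtype
  have hK : K ≤ maximalIdeal (A) ^ (m + 1) := fun x hx => mem_pow_of_coe_mem_pow_succ L κ hA hx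
  haveI : Finite (A ⧸ K) :=
    Finite.of_injective (Ideal.quotientMap _ (A).subtype le_rfl) (Ideal.quotientMap_injective' le_rfl)
  exact Finite.of_surjective (Ideal.Quotient.factor hK) (Ideal.Quotient.factor_surjective hK)

/-- `𝔪_A` is finitely generated: by `ϖ` and the `ϖ · [c]`, `c ∈ k_L` (`[c]` any lift). [folklore] -/
theorem maximalIdeal_fg [FiniteDimensional ℚ_[p] L] : haveI := isLocalRing L κ hA; (maximalIdeal A).FG := by
  classical
  haveI := isLocalRing L κ hA
  haveI := intermediateFieldIntegers.finite_residueField L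
  letI := Fintype.ofFinite (ResidueField (intermediateFieldIntegers p L))
  set ϖ := intermediateFieldIntegers.uniformizer L with hϖ
  have hϖm : ϖ ∈ maximalIdeal (intermediateFieldIntegers p L) := by
    rw [intermediateFieldIntegers.maximalIdeal_eq_span_uniformizer]; exact Ideal.mem_span_singleton_self _
  let lift : ResidueField (intermediateFieldIntegers p L) → intermediateFieldIntegers p L :=
    fun c => (residue_surjective c).choose
  have hlift : ∀ c, residue _ (lift c) = c := fun c => (residue_surjective c).choose_spec
  let gen : ResidueField (intermediateFieldIntegers p L) → A :=
    fun c => ⟨ϖ * lift c, mem_of_mem_maximalIdeal L κ hA (Ideal.mul_mem_right _ _ hϖm)⟩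
  let ϖA : A := ⟨ϖ, mem_of_mem_maximalIdeal L κ hA hϖm⟩
  refine ⟨insert ϖA (Finset.univ.image gen), le_antisymm ?_ ?_⟩
  · rw [Ideal.span_le]
    intro x hx
    rw [Finset.coe_insert, Finset.coe_image, Set.mem_insert_iff, Set.mem_image] at hx
    rcases hx with rfl | ⟨c, -, rfl⟩
    · exact (mem_maximalIdeal_iff L κ hA _).2 hϖm
    · exact (mem_maximalIdeal_iff L κ hA _).2 (Ideal.mul_mem_right _ _ hϖm)
  · intro a ha
    have ha' := (mem_maximalIdeal_iff L κ hA a).1 ha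
    rw [intermediateFieldIntegers.maximalIdeal_eq_span_uniformizer, Ideal.mem_span_singleton'] at ha'
    obtain ⟨y, hy⟩ := ha'
    -- `y = lift ȳ + ϖ z`, so `a = (ϖ lift ȳ) · 1 + ϖ · (ϖ z)`
    have hz : y - lift (residue _ y) ∈ maximalIdeal (intermediateFieldIntegers p L) := by
      rw [← residue_eq_zero_iff, map_sub, hlift, sub_self]
    rw [intermediateFieldIntegers.maximalIdeal_eq_span_uniformizer, Ideal.mem_span_singleton'] at hz
    obtain ⟨z, hz⟩ := hz
    have hzm : z * ϖ ∈ maximalIdeal (intermediateFieldIntegers p L) := Ideal.mul_mem_left _ _ hϖm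
    let zA : A := ⟨z * ϖ, mem_of_mem_maximalIdeal L κ hA hzm⟩
    have ha_eq : a = gen (residue _ y) + zA * ϖA := Subtype.ext (by
      change (a : intermediateFieldIntegers p L) = ϖ * lift (residue _ y) + z * ϖ * ϖ
      rw [← hϖ] at hy hz
      linear_combination -hy - ϖ * hz)
    rw [ha_eq]
    refine Ideal.add_mem _ (Ideal.subset_span ?_) (Ideal.mul_mem_left _ _ (Ideal.subset_span ?_))
    · rw [Finset.coe_insert, Finset.coe_image]
      exact Set.mem_insert_of_mem _ ⟨_, Finset.mem_coe.2 (Finset.mem_univ _), rfl⟩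
    · rw [Finset.coe_insert]
      exact Set.mem_insert _ _

/-- `A` is Noetherian. [cite: Mazur1997Deformation, §10] -/
theorem isNoetherianRing [FiniteDimensional ℚ_[p] L] : IsNoetherianRing A := by
  haveI := isLocalRing L κ hA
  rw [isNoetherianRing_iff_ideal_fg]
  intro I
  by_cases hI : I = ⊥
  · rw [hI]; exact Submodule.fg_bot
  obtain ⟨m, hm⟩ := exists_pow_le_of_ne_bot L κ hA hI
  haveI := finite_quotient_pow L κ hA m
  have hpow : (maximalIdeal (A) ^ (m + 1)).FG := (maximalIdeal_fg L κ hA).pow (n := m + 1)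
  haveI : IsNoetherian (A) (A ⧸ maximalIdeal (A) ^ (m + 1)) := isNoetherian_of_finite _ _
  refine Submodule.fg_of_fg_map_of_fg_inf_ker (maximalIdeal (A) ^ (m + 1)).mkQ ?_ ?_
  · exact IsNoetherian.noetherian _
  · rw [Submodule.ker_mkQ, inf_eq_right.2 hm]
    exact hpow

/-- `A` is `𝔪_A`-adically complete. [cite: Mazur1997Deformation, §10] -/
theorem isAdicComplete [FiniteDimensional ℚ_[p] L] :
    haveI := isLocalRing L κ hA; IsAdicComplete (maximalIdeal A) A := by
  haveI := isLocalRing L κ hA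
  have hpow : ∀ (n : ℕ) (x : A),
      x ∈ (maximalIdeal (A) ^ n • ⊤ : Ideal (A)) ↔ x ∈ maximalIdeal (A) ^ n := by
    intro n x; rw [smul_eq_mul, Ideal.mul_top]
  have hpow' : ∀ (n : ℕ) (x : intermediateFieldIntegers p L),
      x ∈ (maximalIdeal (intermediateFieldIntegers p L) ^ n • ⊤ : Ideal (intermediateFieldIntegers p L)) ↔
        x ∈ maximalIdeal (intermediateFieldIntegers p L) ^ n := by
    intro n x; rw [smul_eq_mul, Ideal.mul_top]
  haveI : IsHausdorff (maximalIdeal (A)) (A) := ⟨fun x hx => by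
    refine Subtype.ext (IsHausdorff.haus (inferInstance : IsHausdorff (maximalIdeal (intermediateFieldIntegers p L))
      (intermediateFieldIntegers p L)) (x : intermediateFieldIntegers p L) fun n => ?_)
    exact SModEq.zero.2 ((hpow' n _).2 (coe_mem_pow L κ hA ((hpow n x).1 (SModEq.zero.1 (hx n)))))⟩
  haveI : IsPrecomplete (maximalIdeal (A)) (A) := ⟨fun {f} hf => by
    have hf' : ∀ {m n : ℕ}, m ≤ n → f m - f n ∈ maximalIdeal (A) ^ m := fun {m n} hmn =>
      (hpow m _).1 (SModEq.sub_mem.1 (hf hmn))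
    obtain ⟨y, hy⟩ := IsPrecomplete.prec (inferInstance : IsPrecomplete (maximalIdeal (intermediateFieldIntegers p L))
      (intermediateFieldIntegers p L)) (f := fun n => (f n : intermediateFieldIntegers p L)) (fun {m n} hmn =>
        SModEq.sub_mem.2 ((hpow' m _).2 (by
          have := coe_mem_pow L κ hA (hf' hmn)
          exact this)))
    have hy' : ∀ n, (f n : intermediateFieldIntegers p L) - y ∈ maximalIdeal (intermediateFieldIntegers p L) ^ n :=
      fun n => (hpow' n _).1 (SModEq.sub_mem.1 (hy n))
    -- the limit lies in `A`: its residue is that of `f 1`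
    have hyA : y ∈ A := by
      obtain ⟨c, hc⟩ := (hA _).1 (f 1).2
      refine (hA _).2 ⟨c, ?_⟩
      have h1 := hy' 1
      rw [pow_one, ← residue_eq_zero_iff, map_sub, sub_eq_zero] at h1
      rw [hc, h1]
    refine ⟨⟨y, hyA⟩, fun n => SModEq.sub_mem.2 ((hpow n _).2 ?_)⟩
    have h1 : f n - f (n + 1) ∈ maximalIdeal (A) ^ n := hf' (Nat.le_succ n)
    have h2 : f (n + 1) - ⟨y, hyA⟩ ∈ maximalIdeal (A) ^ n := mem_pow_of_coe_mem_pow_succ L κ hA (hy' (n + 1))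
    have := Ideal.add_mem _ h1 h2
    rwa [sub_add_sub_cancel] at this⟩
  exact ⟨⟩

/-- **The augmentation `A → k`, `a ↦ κ⁻¹ (a mod λ_L)`**: a surjective ring homomorphism `π : A → k` with
`κ ∘ π = residue`. [cite: Mazur1997Deformation, §10] -/
theorem exists_lift : ∃ π : A →+* k, Function.Surjective π ∧
    ∀ a : A, κ (π a) = residue (intermediateFieldIntegers p L) (a : intermediateFieldIntegers p L) := by
  let e : k ≃+* κ.range := RingEquiv.ofBijective κ.rangeRestrict
    ⟨fun _ _ h => κ.injective (congrArg Subtype.val h : _), κ.rangeRestrict_surjective⟩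
  let π : A →+* k :=
    e.symm.toRingHom.comp ((residue (intermediateFieldIntegers p L)).restrict A κ.range fun a ha => by
      obtain ⟨y, hy⟩ := (hA a).1 ha
      exact ⟨y, hy⟩)
  have h1 : ∀ z : κ.range, κ (e.symm z) = (z : ResidueField (intermediateFieldIntegers p L)) := fun z => by
    conv_rhs => rw [← e.apply_symm_apply z]
    rfl
  have hπ : ∀ a : A, κ (π a) = residue (intermediateFieldIntegers p L) (a : intermediateFieldIntegers p L) :=
    fun a => h1 _
  refine ⟨π, fun y => ?_, hπ⟩
  obtain ⟨a, ha⟩ := residue_surjective (R := intermediateFieldIntegers p L) (κ y)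
  refine ⟨⟨a, (hA _).2 ⟨y, ha.symm⟩⟩, κ.injective ?_⟩
  rw [hπ]
  exact ha

end ResidueRestrict

/-- **Registered sub-goal `stub_seedPatchingPrime_auxResidueRestrict` of stub (P2) `stub_seedPatchingPrime`
(coefficient plumbing): the residue-restricted test ring exists.**  For a finite `L/ℚ_p` inside `ℚ̄_p` and a
field embedding `κ : k → k_L` there is a subring `A ⊆ 𝒪_L` containing every element whose residue lies in
`κ(k)` (in particular `𝔪_L`), which is a complete Noetherian local ring, with a surjection `π : A → k` such that
`κ ∘ π = residue` — Mazur's coefficient ring `𝒪_L ×_{k_L} k` with residue field `k`.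
[cite: Mazur1997Deformation, §10] -/
theorem stub_seedPatchingPrime_auxResidueRestrict :
    ∀ (p : ℕ) [Fact p.Prime] (L : IntermediateField ℚ_[p] (PadicAlgCl p)) [FiniteDimensional ℚ_[p] L]
      (k : Type) [Field k] (κ : k →+* IsLocalRing.ResidueField (intermediateFieldIntegers p L)),
      ∃ (A : Subring (intermediateFieldIntegers p L)) (_ : IsLocalRing A) (_ : IsNoetherianRing A)
        (_ : IsAdicComplete (IsLocalRing.maximalIdeal A) A) (π : A →+* k),
        Function.Surjective π ∧ (∀ a : A, κ (π a) = IsLocalRing.residue _ (a : intermediateFieldIntegers p L)) ∧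
          ∀ a : intermediateFieldIntegers p L, (∃ y : k, κ y = IsLocalRing.residue _ a) → a ∈ A := by
  intro p _ L _ k _ κ
  have hA : ∀ a : intermediateFieldIntegers p L, a ∈ (κ.range).comap (IsLocalRing.residue _) ↔
      ∃ y : k, κ y = IsLocalRing.residue _ a := fun a => ResidueRestrict.mem_comap_range_iff L κ
  obtain ⟨π, hπ, hκπ⟩ := ResidueRestrict.exists_lift L κ hA
  exact ⟨_, ResidueRestrict.isLocalRing L κ hA, ResidueRestrict.isNoetherianRing L κ hA,
    ResidueRestrict.isAdicComplete L κ hA, π, hπ, hκπ, fun a ha => (hA a).2 ha⟩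

end

end Summit.Langlands.Langlands.Cruxes.ReducibleOrdinaryProModular.FineSelmerCodimensionTwo
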